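import Literature.Analysis.FluidPDE.ClassicalSolution
import HarnessLib

/-!
# Steady classical Navier–Stokes solutions on the whole space and linear straining flows

Analysis/FluidPDE definitions file (work item `defn-BurgersVortexInStrain`, wanted by route
`FrozenK41` of `AnomalousDissipation`, items 1214–1216): the vocabulary in which the Burgers
vortex / Burgers layer on `ℝ³` are stated (`BurgersVortex`, `BurgersVortexLayer`,
`BurgersVortexSteady`).

* `IsSteadyClassicalNS ν f u p` — steady classical solutions of forced Navier–Stokes on a
  finite-dimensional inner product space `E`: `u, p ∈ C^∞`, `(u·∇)u = νΔu − ∇p + f`, `div u = 0`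
  pointwise; `isSteadyClassicalNS_iff_const` identifies it with the tree's time-dependent notion
  `IsClassicalNSSolutionOn univ ν (fun _ ↦ f) (fun _ ↦ u) (fun _ ↦ p)` at constant fields.
* `IsSteadyNSInStrain ν U v` — "`U + v` is, for some smooth pressure, a steady classical solution
  of the unforced Navier–Stokes equations with viscosity `ν`" (Gallay–Maekawa 2016, §1: `u = u_s + v`
  with `u_s` the strain (1.18)); no decay condition is built in (the Burgers vortex velocity decays
  like `|x|⁻¹`, the Burgers layer velocity tends to `∓ΔU/2`).
* `linearStrain γ₁ γ₂ γ₃ x = (γ₁x₀, γ₂x₁, γ₃x₂)` (Gallay–Maekawa 2016, (1.18); Frisch 1995, §8.9.1: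
  `U = (αx₁, βx₂, γx₃)`), `axisymmetricStrain γ = linearStrain (−γ/2) (−γ/2) γ`,
  `asymmetricStrain γ l` (Gallay–Wayne 2006, (1.1): rates `−γ(1+λ)/2, −γ(1−λ)/2, γ`),
  `planeStrain γ = linearStrain (−γ) 0 γ`; proved: linearity, smoothness, `div = γ₁ + γ₂ + γ₃`.

Conventions: the axial strain rate is `γ` as in Frisch (1995) and Gallay–Wayne (2006) (the route
writes `α`); the stretching axis is the `x 2`-axis of `EuclideanSpace ℝ (Fin 3)` (indices `0,1,2`),
matching the tree's cylindrical vocabulary (`cylRadius`, `rotGen`, `eZ`).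

Mathlib has no Navier–Stokes notions; the tree's `IsClassicalNSSolutionOn`, `convect`,
`VectorCalculus.divergence/IsDivFree` are reused.

## References

* U. Frisch, *Turbulence*, CUP (1995), §8.9.1, eq. (8.140), PDF p. 140. [Frisch1995]
* Th. Gallay, C. E. Wayne, *Existence and stability of asymmetric Burgers vortices*, J. Math.
  Fluid Mech. 9 (2007) 243–261 = arXiv:math/0503353, (1.1). [GallayWayne2006]
* Th. Gallay, Y. Maekawa, *Existence and stability of viscous vortices*, arXiv:1610.08384, §1
  (1.1), (1.18). [GallayMaekawa2016]
* R. Temam, *Navier–Stokes Equations* (1979), Ch. II §1 (stationary problem). [Temam1979]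
-/

noncomputable section

open Set Function Filter Topology WithLp MeasureTheory
open scoped Laplacian InnerProductSpace RealInnerProductSpace ContDiff

namespace Literature.Analysis.FluidPDE

/-- Local notation for physical space `ℝ³ = EuclideanSpace ℝ (Fin 3)`. -/
local notation "ℝ³" => EuclideanSpace ℝ (Fin 3)

/-! ### Steady classical Navier–Stokes solutions on the whole space -/

section Steady

variable {E : Type*} [NormedAddCommGroup E] [InnerProductSpace ℝ E] [FiniteDimensional ℝ E]

/-- **Steady classical solutions** of the forced incompressible Navier–Stokes system with
viscosity `ν` on the whole space `E`: a velocity `u : E → E` and a pressure `p : E → ℝ`, both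
`C^∞`, with `(u·∇)u = νΔu − ∇p + f` and `div u = 0` pointwise (Gallay–Maekawa 2016, (1.1) with
`∂ₜu = 0`; Temam 1979, Ch. II (1.1)–(1.3) on a domain). This is the time-independent case of the
tree's `IsClassicalNSSolutionOn` (`isSteadyClassicalNS_iff_const`). No decay or integrability at
infinity is required (the Burgers flows grow linearly). [folklore] -/
structure IsSteadyClassicalNS (ν : ℝ) (f u : E → E) (p : E → ℝ) : Prop where
  /-- The velocity is smooth. -/
  smooth_velocity : ContDiff ℝ ∞ u
  /-- The pressure is smooth. -/
  smooth_pressure : ContDiff ℝ ∞ p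
  /-- The steady momentum equation `(u·∇)u = νΔu − ∇p + f` holds pointwise. -/
  momentum : ∀ x, convect u u x = ν • (Δ u) x - gradient p x + f x
  /-- Incompressibility `div u = 0`. -/
  divFree : VectorCalculus.IsDivFree u

omit [FiniteDimensional ℝ E] in
/-- A time-independent field is jointly smooth in space–time iff it is smooth in space. [folklore] -/
theorem isSmoothSpaceTimeOn_const_iff {F : Type*} [NormedAddCommGroup F] [NormedSpace ℝ F]
    (w : E → F) : IsSmoothSpaceTimeOn (univ : Set ℝ) (fun _ : ℝ => w) ↔ ContDiff ℝ ∞ w := by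
  constructor
  · intro h
    exact h.contDiff_slice (mem_univ (0 : ℝ))
  · intro h
    have : uncurry (fun _ : ℝ => w) = w ∘ Prod.snd := rfl
    rw [IsSmoothSpaceTimeOn, this, univ_prod_univ]
    exact (h.comp contDiff_snd).contDiffOn

omit [NormedAddCommGroup E] [InnerProductSpace ℝ E] [FiniteDimensional ℝ E] in
/-- The one-sided time derivative of a time-independent field vanishes. [folklore] -/
theorem timeDerivWithin_const {X F : Type*} [NormedAddCommGroup F] [NormedSpace ℝ F]
    (S : Set ℝ) (w : X → F) (t : ℝ) (x : X) : timeDerivWithin S (fun _ : ℝ => w) t x = 0 := by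
  simp [timeDerivWithin]

/-- **Steady = time-independent classical solution.** `IsSteadyClassicalNS ν f u p` holds iff the
constant-in-time fields form a classical Navier–Stokes solution on the time set `univ` in the
sense of the tree's `IsClassicalNSSolutionOn` (the time derivative of a constant field is `0`).
[folklore] -/
theorem isSteadyClassicalNS_iff_const {ν : ℝ} {f u : E → E} {p : E → ℝ} :
    IsSteadyClassicalNS ν f u p ↔
      IsClassicalNSSolutionOn (univ : Set ℝ) ν (fun _ => f) (fun _ => u) (fun _ => p) := by
  constructor
  · intro h
    exact
      { smooth_velocity := (isSmoothSpaceTimeOn_const_iff u).2 h.smooth_velocity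
        smooth_pressure := (isSmoothSpaceTimeOn_const_iff p).2 h.smooth_pressure
        momentum := fun t _ x => by rw [timeDerivWithin_const, zero_add]; exact h.momentum x
        divFree := fun _ _ => h.divFree }
  · intro h
    exact
      { smooth_velocity := (isSmoothSpaceTimeOn_const_iff u).1 h.smooth_velocity
        smooth_pressure := (isSmoothSpaceTimeOn_const_iff p).1 h.smooth_pressure
        momentum := fun x => by
          have := h.momentum 0 (mem_univ _) x
          rwa [timeDerivWithin_const, zero_add] at this
        divFree := h.divFree 0 (mem_univ _) }

/-- **Steady Navier–Stokes flow in a background strain.** `IsSteadyNSInStrain ν U v`: the total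
velocity `U + v` (background straining flow `U` plus perturbation `v`) is, together with SOME
smooth pressure, a steady classical solution of the UNFORCED Navier–Stokes equations with
viscosity `ν` on the whole space (Gallay–Maekawa 2016, §1: `u = u_s + v` with `u_s` the strain
(1.18); Gallay–Wayne 2006, §1). The pressure is existentially quantified (for the Burgers vortex
it involves exponential integrals); no decay of `v` is imposed here. [cite: GallayMaekawa2016, §1 (1.18)–(1.22)] -/
def IsSteadyNSInStrain (ν : ℝ) (U v : E → E) : Prop :=
  ∃ p : E → ℝ, IsSteadyClassicalNS ν 0 (U + v) p

/-- Unfolding `IsSteadyNSInStrain`. [folklore] -/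
theorem isSteadyNSInStrain_iff {ν : ℝ} {U v : E → E} :
    IsSteadyNSInStrain ν U v ↔ ∃ p : E → ℝ, IsSteadyClassicalNS ν 0 (U + v) p :=
  Iff.rfl

end Steady

/-! ### Linear straining flows on `ℝ³` -/

/-- The diagonal linear straining flow `u_s(x) = (γ₁x₀, γ₂x₁, γ₃x₂) = M x`,
`M = diag(γ₁, γ₂, γ₃)` (Gallay–Maekawa 2016, (1.18); Frisch 1995, §8.9.1: `U = (αx₁, βx₂, γx₃)`).
Incompressible iff `γ₁ + γ₂ + γ₃ = 0` (`divergence_linearStrain`). [cite: GallayMaekawa2016, (1.18)] -/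
def linearStrain (γ₁ γ₂ γ₃ : ℝ) (x : ℝ³) : ℝ³ :=
  toLp 2 ![γ₁ * x 0, γ₂ * x 1, γ₃ * x 2]

/-- Components of the linear strain. [folklore] -/
@[simp] theorem linearStrain_apply_zero (γ₁ γ₂ γ₃ : ℝ) (x : ℝ³) :
    linearStrain γ₁ γ₂ γ₃ x 0 = γ₁ * x 0 := rfl

/-- Components of the linear strain. [folklore] -/
@[simp] theorem linearStrain_apply_one (γ₁ γ₂ γ₃ : ℝ) (x : ℝ³) :
    linearStrain γ₁ γ₂ γ₃ x 1 = γ₂ * x 1 := rfl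

/-- Components of the linear strain. [folklore] -/
@[simp] theorem linearStrain_apply_two (γ₁ γ₂ γ₃ : ℝ) (x : ℝ³) :
    linearStrain γ₁ γ₂ γ₃ x 2 = γ₃ * x 2 := rfl

/-- The linear strain as a continuous linear map `M = diag(γ₁, γ₂, γ₃)`. [folklore] -/
def linearStrainL (γ₁ γ₂ γ₃ : ℝ) : ℝ³ →L[ℝ] ℝ³ :=
  LinearMap.toContinuousLinearMap
    { toFun := linearStrain γ₁ γ₂ γ₃
      map_add' := fun v w => by ext i; fin_cases i <;> (simp [linearStrain]; try ring)
      map_smul' := fun c v => by ext i; fin_cases i <;> (simp [linearStrain]; try ring) }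

/-- The continuous linear map `linearStrainL` is `linearStrain`. [folklore] -/
@[simp] theorem linearStrainL_apply (γ₁ γ₂ γ₃ : ℝ) (x : ℝ³) :
    linearStrainL γ₁ γ₂ γ₃ x = linearStrain γ₁ γ₂ γ₃ x := rfl

/-- The linear strain is its own derivative. [folklore] -/
theorem hasFDerivAt_linearStrain (γ₁ γ₂ γ₃ : ℝ) (x : ℝ³) :
    HasFDerivAt (linearStrain γ₁ γ₂ γ₃) (linearStrainL γ₁ γ₂ γ₃) x :=
  (linearStrainL γ₁ γ₂ γ₃).hasFDerivAt

/-- The linear strain is smooth. [folklore] -/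
theorem contDiff_linearStrain (γ₁ γ₂ γ₃ : ℝ) {n : WithTop ℕ∞} :
    ContDiff ℝ n (linearStrain γ₁ γ₂ γ₃) :=
  (linearStrainL γ₁ γ₂ γ₃).contDiff

/-- **`div u_s = γ₁ + γ₂ + γ₃`**: the divergence of the linear strain is the trace of
`diag(γ₁, γ₂, γ₃)` (Gallay–Maekawa 2016, after (1.18): incompressible iff `γ₁ + γ₂ + γ₃ = 0`). [cite: GallayMaekawa2016, (1.18)] -/
theorem divergence_linearStrain (γ₁ γ₂ γ₃ : ℝ) (x : ℝ³) :
    VectorCalculus.divergence (linearStrain γ₁ γ₂ γ₃) x = γ₁ + γ₂ + γ₃ := by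
  rw [divergence_eq_sum_inner_fderiv (EuclideanSpace.basisFun (Fin 3) ℝ),
    (hasFDerivAt_linearStrain γ₁ γ₂ γ₃ x).fderiv]
  simp [Fin.sum_univ_three, linearStrain, EuclideanSpace.inner_single_left]

/-- The **axisymmetric strain** `U_s(x) = (−γx₀/2, −γx₁/2, γx₂)` with axial stretching rate `γ`
(Frisch 1995, §8.9.1, the case `α = β`; Gallay–Maekawa 2016, (1.21): `γ₁ = γ₂ = −γ/2, γ₃ = γ`). [cite: Frisch1995, §8.9.1 eq. (8.140)] -/
def axisymmetricStrain (γ : ℝ) : ℝ³ → ℝ³ :=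
  linearStrain (-γ / 2) (-γ / 2) γ

/-- The **asymmetric strain** of Gallay–Wayne with asymmetry parameter `l = λ ∈ [0, 1)`:
rates `γ₁ = −γ(1+λ)/2`, `γ₂ = −γ(1−λ)/2`, `γ₃ = γ` (Gallay–Wayne 2006, (1.1)); `λ = 0` is the
axisymmetric strain (`asymmetricStrain_zero`). [cite: GallayWayne2006, (1.1)] -/
def asymmetricStrain (γ l : ℝ) : ℝ³ → ℝ³ :=
  linearStrain (-γ / 2 * (1 + l)) (-γ / 2 * (1 - l)) γ

/-- The **plane strain** `(−γx₀, 0, γx₂)` hosting the Burgers vortex layer (the limit `λ = 1` of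
Gallay–Wayne's (1.1): `γ₂ = 0`). [cite: GallayWayne2006, (1.1) (λ = 1)] -/
def planeStrain (γ : ℝ) : ℝ³ → ℝ³ :=
  linearStrain (-γ) 0 γ

/-- `λ = 0` gives back the axisymmetric strain. [folklore] -/
@[simp] theorem asymmetricStrain_zero (γ : ℝ) : asymmetricStrain γ 0 = axisymmetricStrain γ := by
  simp [asymmetricStrain, axisymmetricStrain]

/-- `λ = 1` gives the plane strain. [folklore] -/
@[simp] theorem asymmetricStrain_one (γ : ℝ) : asymmetricStrain γ 1 = planeStrain γ := by
  funext x; ext i; fin_cases i <;> (simp [asymmetricStrain, planeStrain, linearStrain]; try ring)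

/-- The straining flows are divergence free. [folklore] -/
theorem isDivFree_asymmetricStrain (γ l : ℝ) : VectorCalculus.IsDivFree (asymmetricStrain γ l) :=
  fun x => by rw [asymmetricStrain, divergence_linearStrain]; ring

/-- The axisymmetric strain is divergence free (`−γ/2 − γ/2 + γ = 0`). [folklore] -/
theorem isDivFree_axisymmetricStrain (γ : ℝ) : VectorCalculus.IsDivFree (axisymmetricStrain γ) :=
  fun x => by rw [axisymmetricStrain, divergence_linearStrain]; ring

/-- The plane strain is divergence free. [folklore] -/
theorem isDivFree_planeStrain (γ : ℝ) : VectorCalculus.IsDivFree (planeStrain γ) :=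
  fun x => by rw [planeStrain, divergence_linearStrain]; ring

/-- The straining flows are smooth. [folklore] -/
theorem contDiff_axisymmetricStrain (γ : ℝ) {n : WithTop ℕ∞} : ContDiff ℝ n (axisymmetricStrain γ) :=
  contDiff_linearStrain _ _ _

end Literature.Analysis.FluidPDE
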